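import Summits.AtomisticToContinuum.Crystallization.Theses.GappedShellCensus
import Summits.AtomisticToContinuum.Crystallization.Theorems.RadialDefectsVanish.Negative.FalseWithoutGS
import Summits.AtomisticToContinuum.Crystallization.Theorems.ReggeStarCoercivityStarCoercivityCoarseTierTransfer
import Summits.AtomisticToContinuum.Crystallization.Theorems.ChargedEnergyGap.Negative.Unconditional
import Literature.MathematicalPhysics.StatisticalMechanics.LennardJonesClusters

/-!
# Disproof of `RadialDefectsVanish` (stmt-AtomisticToContinuum-15930) — findings of the crux disprover (gen 2)

Crux (route `GappedShellCensus`, rank 3; `radialDefectsVanish_iff` in the landed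
`Theorems/RadialDefectsVanish/Negative/FalseWithoutGS.lean` is `Iff.rfl`):
for every sequence of Lennard-Jones ground states `x^N` there is ONE scale `a ∈ [47/50, 1]` such that
for every `θ > 0`, FREQUENTLY in `N`, at most `θN` sites fail to be gapped-twelve at scale `a`
(twelve others at distance `∈ [0.98a, 1.02a]`, none closer, none in `(1.02a, 1.26a)`).

**VERDICT (gen 2): NO KILL — the statement resists for a structural reason; what can be certified
about its shape is recorded below as kernel-checked theorems (no `sorry`; axioms ⊆ {propext,
Classical.choice, Quot.sound}).**  `¬ RadialDefectsVanish` demands a sequence of TRUE minimisers with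
a positive density of radially bad sites at EVERY scale of the window, eventually in `N`; tree and
print know about 3-D Lennard-Jones minimisers only: existence, `1/3`-separation, site energies `≤ 0`,
`E(N)/N → e*` (BlancLewin2015 §2.3: crystallization "completely open in dimension three").  None of
these forces a radial defect anywhere in the bulk (see "Near-misses": not even ONE bad site is
certifiable at tolerance `1/50`); conversely the conjectured minimisers (hcp/fcc bulk at
`a* = 0.97123`, second shell `√2·a* = 1.3735 > 1.26`) satisfy the conclusion at every
`a ∈ [a*/1.02, a*/0.98] = [0.9522, 0.9910] ⊂ [0.94, 1]` (numerics: `NumericsIdeator1.md`, gen-1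
ATTACK.md).  No formalisation defect short-cuts this (gen-1 junk audit: all numerals real, `V_LJ(0) = 0`
unreachable by injectivity, `e*` a genuine infimum, ground states exist so the hypothesis is not
vacuous; NEW §4: the GOOD predicate is satisfiable, so `#bad = N` is not forced syntactically).

## Landed / proposed copies (Theorems/RadialDefectsVanish/Negative/, all `--supports stmt-15930`)

* gen 1: `FalseWithoutGS.lean` (p127161, in tree): `radialDefectsVanish_iff`, `IsGappedTwelveAt`,
  `RadialConclusion`, `dilatedLine`, `radialDefectsVanish_false_without_GS`.
* gen 2: `ScaleLock.lean` (p134702 ACCEPTED: §1, §2, §4), `TorusRigidityScales.lean` (p134715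
  ACCEPTED: §5), `NearGroundStates.lean` (p134790 ACCEPTED: §3 + the definitions and geometry of §6;
  reuses `ChargedEnergyGapNegative.{e0, dimer, groundStateEnergy_nonpos}` and
  `SlackRigidityNegative.{gs, gs_isGroundState}`), `NearGroundStatesEnergy.lean` (p135099 ACCEPTED:
  §6 energy + counting, theorem-only) and `NearGroundStatesRefuted.lean` (p135330 ACCEPTED: §6
  `not_radialDefectsVanishNear`, `radialCoercivity_cap`; theorem-only, `e* < 0` inlined there since
  `…MuGSCBasics.eStar_neg` already states it).
  Importers should prefer those modules; this workfile keeps self-contained copies in its own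
  namespace.

## Index of findings

* §1 SCALE EXCLUSIVITY `not_isGappedTwelveAt_of_isGappedTwelveAt`: if `1.02a < 0.98a'` and
  `1.02a' < 1.26a` (ratio `a'/a ∈ (1.0408, 1.2353)`; e.g. the window's ends `a = 47/50`, `a' = 1`),
  no site is good at both scales; hence `le_card_bad_add_card_bad : N ≤ #bad_a + #bad_{a'}`.
* §2 SCALE LOCK (any sequence, no energy needed): `∀ᶠ N, #bad_a ≤ θN` excludes even
  `∃ᶠ N, #bad_{a'} ≤ θ'N` at every exclusive `a'` when `θ + θ' < 1`
  (`scaleLock_of_eventually_small`, `scaleLock_of_eventually_large`).  NATURAL STRENGTHENING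
  REFUTED: `not_radialDefectsVanishEveryScaleEventually` — the crux with "`∀ a ∈ [47/50, 1]`" and
  "`∀ᶠ N`" is FALSE (along the tree's ground states the two ends of the window cannot both be
  eventually `1/3`-good).  NOT refuted: "`∀ a`, `∃ᶠ N`" (two frequently-sets need not meet — that
  would take structure of true minimisers) and "`∃ a`, `∀ᶠ N`" (what Bridge B actually proves).
  Moral: the `∃ a` is a genuine SELECTION — the eventually-good scales of one sequence form a set of
  multiplicative width `< 1.0408²` — so a proof must PRODUCE `a ≈ a*` from the energy.
* §3 `not_radialDefectsVanishFor_zero`: the crux with `V_LJ` replaced by the ZERO potential is FALSE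
  (every injective configuration is a ground state of `0`, `isGroundState_zero`; dilated line).  With
  gen 1's `radialDefectsVanish_false_without_GS`: injectivity + minimality FORMALLY give nothing; the
  Lennard-Jones well must enter quantitatively.
* §4 SANITY `isGappedTwelveFin_fcc13`: the centre of the fcc cluster at bond length `0.98995` IS
  gapped-twelve at `a = 1` — the good predicate is satisfiable (no refutation for a trivial reason).
* §5 LINE `Sketch` / spine B — the open core `stub_rdvTorusRigidity` (read back VERBATIM against the
  ledger signature: `stubTorusRigidity_iff`, `Iff.rfl`).  `exists_sep_nearMin_periodic`: near-minimising
  `δ`-separated periodic configurations exist at one FIXED `δ > 0` for every `η > 0` (periodised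
  ground states; `crysEnergyLimit`, `CoarseTierTransfer.exists_periodicConfiguration` /
  `energyPerParticle_le`, general-`δ` separation transfer `separated_points_of_le_two`) — the input
  Bridge B feeds to the stub, here powering: `not_torusRigidityAt_and` / `not_forall_torusRigidityAt`
  (the stub cannot hold at two exclusive scales: its `∃ a` cannot become `∀ a ∈ [47/50, 1]`), and
  `not_torusRigidityWithoutNearMinAt` (the hypothesis `e(P) ≤ e* + η` is load-bearing: one point
  periodised with periods `≥ 2` is `2`-separated and all-bad at every `a ≤ 1`).  NOT refuted, believed
  harmless: the `δ`-separation hypothesis of the stub (cf. `Cruxes/CoerciveTwoShellGap/Disproof.lean`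
  §2, where the analogous constant is uniform in `δ`).  The bookkeeping stubs `stub_rdvSeparatedPoints`
  (= `separated_points_of_le_two` below, PROVED here as a helper) and `stub_rdvGappedIff` are true
  (translates are `≥ 2 > 63a/50` away; shell counts agree by injectivity), and the three stubs are
  jointly sufficient (Bridge B yields the crux even with `∀ᶠ N`) — no gap is smuggled by `_of`.
* §6 **MINIMALITY IS LOAD-BEARING TO EVERY ORDER** `not_radialDefectsVanishNear`: for EVERY `κ > 0`
  the crux is FALSE for sequences of `κ`-NEAR ground states (`E(x^N) ≤ (1 − κ)·E(N)`, recall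
  `E(N) ≤ 0`), although `RadialDefectsVanishNear 0 ↔ RadialDefectsVanish`
  (`radialDefectsVanishNear_zero_iff`) and the family is antitone (`RadialDefectsVanishNear.anti`):
  the crux sits exactly at the endpoint `κ = 0` of a family that is false on `(0, ∞)`.  Witness
  `mix K M`: `K ≈ 2/κ` far-apart copies of a ground state of `⌊M/(K+1)⌋` particles plus ONE copy
  DILATED by `21/20` (+ `M mod (K+1)` isolated particles).  By scale exclusivity at most
  `K·⌊M/(K+1)⌋` of its `M` sites are good at ANY scale `a ∈ (0, 1]` (`card_good_mix_le`: good sites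
  of the undilated copies are good sites of `x^N` at `a`, those of the dilated copy are good sites of
  `x^N` at the exclusive scale `(20/21)a`, and the two good sets of `x^N` are disjoint), while
  `E(mix) ≤ (K + (20/21)⁶)·E(⌊M/(K+1)⌋)` (`interactionEnergy_mix_le`, from
  `V_LJ(λr) ≤ λ⁻⁶·V_LJ(r)` for `λ ≥ 1`, `lennardJones_mul_le`; cross-copy terms `≤ 0`) makes it
  `κ`-near for all large `M` (`eventually_mix_near`: `E(N)/N → e*`, `M·e* ≤ E(M)`, `e* < 0`).
  CONSEQUENCES FOR PROVERS: (i) no argument may pass through "energy within `κ|e*|` per particle of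
  optimal" for a fixed `κ > 0`; the proof must use `E(x^N) − E(N) = o(N)` (here `= 0`) — consistent
  with Bridge B, which spends exactly `E(N)/N − e* → 0`; (ii) a CERTIFIED CAP on any linear coercivity
  constant: bad fraction `θ ≤ 1/2` at every scale is compatible with excess energy
  `≤ (1 − (20/21)⁶ + o(1))·|e*|·θ ≈ 0.254·|e*|·θ` per particle (take `K + 1 ≈ 1/θ`), so an
  inequality "`E(x) − N e* ≥ g·#bad_a(x)`" valid for all injective `x` and some admissible `a` forces
  `g ≤ (1 − (20/21)⁶)·|e*| ≈ 0.254·|e*| ≈ 0.18` — CERTIFIED as `radialCoercivity_cap` (test on the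
  `K = 1` mixture; numerics: the true price is the rattler, `g ≈ |e*|/400`, `NumericsIdeator1.md` §B;
  letting `λ ↓ 1.02/0.98` would improve `0.254` to `0.213`).

## Near-misses — why the remaining natural strengthenings are NOT certified (no `sorry` kept)

* "`θ = 0`", "`#bad = O(1)`", "`#bad = o(N^{2/3})`" are physically false (the surface!), but the only
  cheap certificate — every finite configuration has a radially bad site, because a convex-hull vertex
  sees its twelve mutually `0.98a`-separated neighbours in a closed half-space — FAILS at tolerance
  `1/50` by a hair: the cap-packing bound `Literature…SphericalCodeHemisphere.card_mul_le_of_code_in_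
  hemisphere` (used at separation `55/57` in `Cruxes/TwelveWithinOne/Disproof.lean` Part C) needs
  `12(1 − c) > 1 + √(1 − c²)` with `c = cos ρ`, `2ρ` the minimal bond angle; here
  `cos 2ρ = 1 − 0.98²/(2·1.02²) = 0.53845`, `2ρ = 57.42°`, `c = 0.87706`, and
  `12(1 − c) = 1.4753 < 1.4804 = 1 + √(1 − c²)`.  The area argument works iff the radial/pair
  tolerance `τ` has `(1 − τ)/(1 + τ) ≥ 0.96266`, i.e. `τ ≤ 0.0190`; at `τ = 1/50` one needs a genuine
  one-sided-kissing theorem (K. Bezdek's `B(3) = 9` type), not in tree.  Upshot: at this tolerance NO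
  lower bound on `#bad` for true ground states — not even `#bad ≥ 1` — is currently certifiable, which
  is the precise sense in which the crux "resists".
* A FIXED scale (say `a = 1`, or any `a ∉ [0.9522, 0.9910]`): refuting the crux there needs a certified
  lower bound on the energy of configurations mostly gapped-twelve at scale `a` beating `e* + 0.002`
  per particle — a near-sharp lattice-sum bound over arbitrary `0.98`-separated point sets, i.e. the
  crystallization problem itself (crude packing tails are off by `50 %`).
* Tolerance `→ 0` (exact distances) would need true minimisers to be generically relaxed — unknown.
* Dropping `δ`-separation in the stub: believed TRUE (close pairs cost `V_LJ → +∞`); not attacked.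

Numerology: `0.98·(21/20) = 1.029 > 1.02`, `1.02·(21/20) = 1.071 < 1.26`, `(20/21)⁶ = 0.7462`;
`a* = 0.97123`, `e* ≈ −0.7175` (uncertified; certified elsewhere in tree: `e* ≤ −0.711`, and here
`e* ≤ −1/24`, `eStar_lt_zero`).
-/

noncomputable section

open scoped Classical
open Filter
open Literature.MathematicalPhysics.StatisticalMechanics
open Summit.AtomisticToContinuum.Crystallization.Theses.GappedShellCensus
open Summit.AtomisticToContinuum.Crystallization.Theorems.RadialDefectsVanish.Negative
open Summit.AtomisticToContinuum.Crystallization.Theorems (CoarseTierTransfer.exists_periodicConfiguration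
  CoarseTierTransfer.two_le_dist_of_mem_points CoarseTierTransfer.energyPerParticle_le)
open Summit.AtomisticToContinuum.Crystallization.Theorems.ChargedEnergyGapNegative (eStar card_mul_eStar_le
  crysEnergyLimit eStar_le_groundStateEnergy_div)

namespace Summit.AtomisticToContinuum.Crystallization.Cruxes.RadialDefectsVanish.Disproof

local notation "E3" => EuclideanSpace ℝ (Fin 3)

/-! ## §1 Two admissible scales are mutually exclusive at every site -/

variable {x : (N : ℕ) → (Fin N → E3)}

/-- **Scale exclusivity.** If `1.02·a < 0.98·a'` and `1.02·a' < 1.26·a` (e.g. `a = 47/50`, `a' = 1`: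
`0.9588 < 0.98`, `1.02 < 1.1844`), a site that is gapped-twelve at scale `a'` is NOT gapped-twelve at
scale `a`: it has a neighbour at distance `d ∈ [0.98a', 1.02a']`, and that `d` lies in the forbidden
annulus `(1.02a, 1.26a)` of scale `a`. [folklore] -/
theorem not_isGappedTwelveAt_of_isGappedTwelveAt {a a' : ℝ}
    (h1 : a * (1 + 1 / 50) < a' * (1 - 1 / 50)) (h2 : a' * (1 + 1 / 50) < a * (63 / 50))
    {N : ℕ} {i : Fin N} (h : IsGappedTwelveAt x a' N i) : ¬ IsGappedTwelveAt x a N i := by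
  rintro ⟨-, hfar⟩
  obtain ⟨hcard, hfar'⟩ := h
  have hne : (Finset.univ.filter fun j : Fin N =>
      j ≠ i ∧ dist (x N i) (x N j) ≤ a' * (1 + 1 / 50)).Nonempty := by
    rw [← Finset.card_pos, hcard]; norm_num
  obtain ⟨j, hj⟩ := hne
  simp only [Finset.mem_filter, Finset.mem_univ, true_and] at hj
  obtain ⟨hji, hd⟩ := hj
  obtain ⟨hlo, -⟩ := hfar' j hji
  obtain ⟨-, hor⟩ := hfar j hji
  rcases hor with h | h <;> linarith

/-- Hence at two exclusive scales the bad counts add up to at least `N`: every site is bad at `a`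
or bad at `a'`. [folklore] -/
theorem le_card_bad_add_card_bad {a a' : ℝ}
    (h1 : a * (1 + 1 / 50) < a' * (1 - 1 / 50)) (h2 : a' * (1 + 1 / 50) < a * (63 / 50)) (N : ℕ) :
    (N : ℝ) ≤ (Nat.card {i : Fin N // ¬ IsGappedTwelveAt x a N i} : ℝ) +
      (Nat.card {i : Fin N // ¬ IsGappedTwelveAt x a' N i} : ℝ) := by
  have key : ∀ i : Fin N, ¬ IsGappedTwelveAt x a N i ∨ ¬ IsGappedTwelveAt x a' N i := fun i => by
    by_cases h : IsGappedTwelveAt x a' N i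
    · exact Or.inl (not_isGappedTwelveAt_of_isGappedTwelveAt h1 h2 h)
    · exact Or.inr h
  have hN : N ≤ Nat.card {i : Fin N // ¬ IsGappedTwelveAt x a N i} +
      Nat.card {i : Fin N // ¬ IsGappedTwelveAt x a' N i} := by
    rw [Nat.card_eq_fintype_card, Nat.card_eq_fintype_card, Fintype.card_subtype,
      Fintype.card_subtype]
    calc N = (Finset.univ : Finset (Fin N)).card := by simp
      _ = (Finset.univ.filter fun i : Fin N =>
            ¬ IsGappedTwelveAt x a N i ∨ ¬ IsGappedTwelveAt x a' N i).card := by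
          rw [Finset.filter_true_of_mem fun i _ => key i]
      _ ≤ _ := by
          rw [Finset.filter_or]; exact Finset.card_union_le _ _
  exact_mod_cast hN

/-! ## §2 SCALE LOCK for the crux: eventual radial order at one scale forbids even frequent radial
order at every exclusive scale; the strengthening "every scale of the window works" is FALSE -/

/-- Abstract lock: if the bad counts at `b` and `b'` always add up to `≥ N`, then
`∀ᶠ N, #bad_b ≤ θN` and `∃ᶠ N, #bad_{b'} ≤ θ'N` are incompatible when `θ + θ' < 1`. [folklore] -/
theorem not_frequently_le_of_eventually_le {b b' θ θ' : ℝ}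
    (hcount : ∀ N : ℕ, (N : ℝ) ≤ (Nat.card {i : Fin N // ¬ IsGappedTwelveAt x b N i} : ℝ) +
      (Nat.card {i : Fin N // ¬ IsGappedTwelveAt x b' N i} : ℝ)) (hθ : θ + θ' < 1)
    (hev : ∀ᶠ N : ℕ in atTop, (Nat.card {i : Fin N // ¬ IsGappedTwelveAt x b N i} : ℝ) ≤ θ * N) :
    ¬ ∃ᶠ N : ℕ in atTop, (Nat.card {i : Fin N // ¬ IsGappedTwelveAt x b' N i} : ℝ) ≤ θ' * N := by
  intro hfr
  obtain ⟨N, ⟨hN1, hN2⟩, hN⟩ :=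
    ((hev.and_frequently hfr).and_eventually (eventually_ge_atTop 1)).exists
  have hNr : (1 : ℝ) ≤ N := by exact_mod_cast hN
  have hlt : θ * N + θ' * N < (N : ℝ) := by
    have := mul_lt_mul_of_pos_right hθ (by linarith : (0 : ℝ) < N)
    rwa [add_mul, one_mul] at this
  have := hcount N
  linarith

/-- **Scale lock (small scale eventually good).** For ANY sequence `x` (ground states or not): if
eventually all but `θN` sites are gapped-twelve at scale `a`, then at every exclusive larger scale
`a'` (`1.02a < 0.98a'`, `1.02a' < 1.26a`) it is not even FREQUENTLY true that all but `θ'N` sites are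
gapped-twelve, whenever `θ + θ' < 1`. [folklore] -/
theorem scaleLock_of_eventually_small {a a' θ θ' : ℝ}
    (h1 : a * (1 + 1 / 50) < a' * (1 - 1 / 50)) (h2 : a' * (1 + 1 / 50) < a * (63 / 50))
    (hθ : θ + θ' < 1)
    (hev : ∀ᶠ N : ℕ in atTop, (Nat.card {i : Fin N // ¬ IsGappedTwelveAt x a N i} : ℝ) ≤ θ * N) :
    ¬ ∃ᶠ N : ℕ in atTop, (Nat.card {i : Fin N // ¬ IsGappedTwelveAt x a' N i} : ℝ) ≤ θ' * N :=
  not_frequently_le_of_eventually_le (le_card_bad_add_card_bad h1 h2) hθ hev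

/-- **Scale lock (large scale eventually good)**, the mirror statement. [folklore] -/
theorem scaleLock_of_eventually_large {a a' θ θ' : ℝ}
    (h1 : a * (1 + 1 / 50) < a' * (1 - 1 / 50)) (h2 : a' * (1 + 1 / 50) < a * (63 / 50))
    (hθ : θ + θ' < 1)
    (hev : ∀ᶠ N : ℕ in atTop, (Nat.card {i : Fin N // ¬ IsGappedTwelveAt x a' N i} : ℝ) ≤ θ * N) :
    ¬ ∃ᶠ N : ℕ in atTop, (Nat.card {i : Fin N // ¬ IsGappedTwelveAt x a N i} : ℝ) ≤ θ' * N :=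
  not_frequently_le_of_eventually_le
    (fun N => by rw [add_comm]; exact le_card_bad_add_card_bad h1 h2 N) hθ hev

/-- NATURAL STRENGTHENING 1 — "every scale of the window works, eventually":
`RadialDefectsVanish` with `∃ a ∈ [47/50, 1]` replaced by `∀ a ∈ [47/50, 1]` and `∃ᶠ N` by `∀ᶠ N`. -/
def RadialDefectsVanishEveryScaleEventually : Prop :=
  ∀ x : (N : ℕ) → (Fin N → E3), (∀ N, IsGroundState lennardJones (x N)) →
    ∀ a : ℝ, 47 / 50 ≤ a → a ≤ 1 → ∀ θ : ℝ, 0 < θ → ∀ᶠ N : ℕ in atTop,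
      (Nat.card {i : Fin N // ¬ IsGappedTwelveAt x a N i} : ℝ) ≤ θ * N

/-- **Strengthening 1 is FALSE**: the two ends `a = 47/50` and `a' = 1` of the window are exclusive
scales, so along the (existing, `LennardJonesGroundStatesExist_holds`) sequence of ground states they
cannot both be eventually `1/3`-good.  Moral for provers: the `∃ a` of the crux is a genuine
selection (the set of scales at which a given sequence is eventually `θ`-good for all `θ` has
multiplicative width `≤ 1.02²/0.98² ≈ 1.083` and cannot contain two exclusive scales); any proof
must produce the scale — physically `a* ≈ 0.9712`, the relaxed close-packed bond length — from the
energy, it cannot be read off the window. [folklore] -/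
theorem not_radialDefectsVanishEveryScaleEventually : ¬ RadialDefectsVanishEveryScaleEventually := by
  intro h
  choose x hx using LennardJonesGroundStatesExist_holds
  have hsmall := h x hx (47 / 50) le_rfl (by norm_num) (1 / 3) (by norm_num)
  have hlarge := h x hx 1 (by norm_num) le_rfl (1 / 3) (by norm_num)
  exact scaleLock_of_eventually_small (x := x) (by norm_num) (by norm_num) (by norm_num) hsmall
    hlarge.frequently

/-! ## §3 The crux for the ZERO potential is false: `IsGroundState`-formalities are not enough -/

/-- The crux with the pair potential as a parameter (`RadialDefectsVanishFor lennardJones` is the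
route decl, `Iff.rfl`). -/
def RadialDefectsVanishFor (V : ℝ → ℝ) : Prop :=
  ∀ x : (N : ℕ) → (Fin N → E3), (∀ N, IsGroundState V (x N)) → RadialConclusion x

/-- Read-back: at `V = V_LJ` this is the route decl. -/
theorem radialDefectsVanishFor_lennardJones_iff :
    RadialDefectsVanishFor lennardJones ↔ RadialDefectsVanish := Iff.rfl

/-- The conclusion of the crux fails for the dilated line `i ↦ 2i·e₀` (every site is bad at every
scale `a ≤ 1`; the argument of `radialDefectsVanish_false_without_GS`, factored). [folklore] -/
theorem not_radialConclusion_dilatedLine : ¬ RadialConclusion dilatedLine := by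
  rintro ⟨a, -, ha1, hθ⟩
  have hhalf := hθ (1 / 2) (by norm_num)
  rw [Filter.frequently_atTop] at hhalf
  obtain ⟨N, hN1, hN⟩ := hhalf 1
  have hcardN : Nat.card {i : Fin N // ¬ IsGappedTwelveAt dilatedLine a N i} = N := by
    rw [Nat.card_congr (Equiv.subtypeUnivEquiv fun i => not_isGappedTwelveAt_dilatedLine ha1 N i),
      Nat.card_eq_fintype_card, Fintype.card_fin]
  rw [hcardN] at hN
  have hN1' : (1 : ℝ) ≤ N := by exact_mod_cast hN1
  linarith

/-- The dilated line is injective. [folklore] -/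
theorem dilatedLine_injective (N : ℕ) : Function.Injective (dilatedLine N) := by
  intro i j h
  by_contra hne
  have h2 := two_le_dist_dilatedLine N (Ne.symm hne)
  rw [h, dist_self] at h2
  norm_num at h2

/-- **The crux for the zero potential is FALSE**: every injective configuration is a ground state of
`V = 0` (`isGroundState_zero`), in particular the dilated line.  So a proof of `RadialDefectsVanish`
must use the Lennard-Jones well quantitatively — injectivity + minimality ALONE (the formal content
of `IsGroundState`) force no radial order. [folklore] -/
theorem not_radialDefectsVanishFor_zero : ¬ RadialDefectsVanishFor fun _ => 0 := fun h =>
  not_radialConclusion_dilatedLine (h dilatedLine fun N => isGroundState_zero (dilatedLine_injective N))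

/-! ## §4 Sanity: the GOOD predicate is satisfiable (the crux is not false for a trivial reason) -/

/-- Integer coordinate table (unit `1/10`): centre and the twelve fcc shell vectors `(±7, ±7, 0)` and
permutations (bond length `7√2/10 = 0.98995 ∈ [0.98, 1.02]`). -/
def tab : Fin 13 → Fin 3 → ℤ :=
  ![![0, 0, 0], ![7, 7, 0], ![7, -7, 0], ![-7, 7, 0], ![-7, -7, 0], ![7, 0, 7], ![7, 0, -7],
    ![-7, 0, 7], ![-7, 0, -7], ![0, 7, 7], ![0, 7, -7], ![0, -7, 7], ![0, -7, -7]]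

/-- Squared distances of the table, in units `1/100`. -/
def sqd (i j : Fin 13) : ℤ := ∑ k : Fin 3, (tab i k - tab j k) ^ 2

/-- The twelve shell points are at squared distance exactly `98` from the centre. [folklore] -/
theorem sqd_shell : ∀ j : Fin 13, j ≠ 0 → sqd 0 j = 98 := by decide

/-- The fcc cluster: centre plus first coordination shell at bond length `0.98995`. -/
def fcc13 (i : Fin 13) : E3 := WithLp.toLp 2 fun k => ((tab i k : ℝ)) / 10

/-- Squared distances of `fcc13` from the integer table. [folklore] -/
theorem dist_sq_fcc13 (i j : Fin 13) : dist (fcc13 i) (fcc13 j) ^ 2 = (sqd i j : ℝ) / 100 := by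
  rw [EuclideanSpace.dist_eq, Real.sq_sqrt (Finset.sum_nonneg fun _ _ => sq_nonneg _)]
  simp only [fcc13, PiLp.toLp_apply, Real.dist_eq, sq_abs, sqd]
  push_cast
  rw [Finset.sum_div]
  exact Finset.sum_congr rfl fun k _ => by ring

/-- Shell distances of `fcc13` lie in `[0.98, 1.02]` (indeed `dist² = 0.98`). [folklore] -/
theorem shell_fcc13 {j : Fin 13} (h : j ≠ 0) :
    1 * (1 - 1 / 50) ≤ dist (fcc13 0) (fcc13 j) ∧ dist (fcc13 0) (fcc13 j) ≤ 1 * (1 + 1 / 50) := by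
  have hsq : dist (fcc13 0) (fcc13 j) ^ 2 = 98 / 100 := by
    rw [dist_sq_fcc13, sqd_shell j h]; norm_num
  have hd : 0 ≤ dist (fcc13 0) (fcc13 j) := dist_nonneg
  constructor <;> nlinarith

/-- Single-configuration reading of `IsGappedTwelveAt` (which takes a whole sequence):
`IsGappedTwelveAt X a N i = IsGappedTwelveFin a (X N) i` by `rfl`. -/
def IsGappedTwelveFin (a : ℝ) {N : ℕ} (y : Fin N → E3) (i : Fin N) : Prop :=
  (Finset.univ.filter fun j : Fin N => j ≠ i ∧ dist (y i) (y j) ≤ a * (1 + 1 / 50)).card = 12 ∧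
    ∀ j : Fin N, j ≠ i → a * (1 - 1 / 50) ≤ dist (y i) (y j) ∧
      (dist (y i) (y j) ≤ a * (1 + 1 / 50) ∨ a * (63 / 50) ≤ dist (y i) (y j))

/-- Read-back: the sequence predicate at `N` is the single-configuration predicate. [folklore] -/
theorem isGappedTwelveAt_eq (X : (N : ℕ) → (Fin N → E3)) (a : ℝ) (N : ℕ) (i : Fin N) :
    IsGappedTwelveAt X a N i = IsGappedTwelveFin a (X N) i := rfl

/-- **The good predicate is satisfiable**: the centre of `fcc13` is gapped-twelve at scale `a = 1`
(twelve neighbours at `0.98995 ∈ [0.98, 1.02]`, nothing else).  So `#bad = N` is NOT forced by the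
shape of the predicate, and the crux is not refutable for a trivial reason. [folklore] -/
theorem isGappedTwelveFin_fcc13 : IsGappedTwelveFin 1 fcc13 0 := by
  refine ⟨?_, fun j hj => ⟨(shell_fcc13 hj).1, Or.inl (shell_fcc13 hj).2⟩⟩
  have hset : (Finset.univ.filter fun j : Fin 13 => j ≠ 0 ∧ dist (fcc13 0) (fcc13 j) ≤ 1 * (1 + 1 / 50))
      = Finset.univ.filter fun j : Fin 13 => j ≠ 0 := by
    refine Finset.filter_congr fun j _ => ⟨fun h => h.1, fun h => ⟨h, (shell_fcc13 h).2⟩⟩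
  rw [hset]
  decide

/-! ## §5 Line `Sketch` (spine B, radial torus rigidity): the open core `stub_rdvTorusRigidity` -/

/-- Point `y` is gapped-twelve at scale `a` read in the (infinite) point set `S` — the inline clause of
the stub (and of `CleanLocalLimit` / `TornFree`).  An `abbrev`, so that `Finset.filter` finds the same
decidability instances as for the inline spelling. -/
abbrev IsGappedTwelveSet (a : ℝ) (S : Set E3) (y : E3) : Prop :=
  {w ∈ S | w ≠ y ∧ dist y w ≤ a * (1 + 1 / 50)}.ncard = 12 ∧
    ∀ w ∈ S, w ≠ y → a * (1 - 1 / 50) ≤ dist y w ∧ (dist y w ≤ a * (1 + 1 / 50) ∨ a * (63 / 50) ≤ dist y w)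

/-- The body of `stub_rdvTorusRigidity` at a given scale `a`. -/
def TorusRigidityAt (a : ℝ) : Prop :=
  ∀ δ : ℝ, 0 < δ → ∀ θ : ℝ, 0 < θ → ∃ η : ℝ, 0 < η ∧
    ∀ P : PeriodicConfiguration 3, (∀ u ∈ P.points, ∀ v ∈ P.points, u ≠ v → δ ≤ dist u v) →
      P.energyPerParticle lennardJones ≤ eStar + η →
        ((P.motif.filter fun y => ¬ IsGappedTwelveSet a P.points y).card : ℝ) ≤ θ * P.motif.card

/-- `stub_rdvTorusRigidity` of the lead's skeleton (line `Sketch`, spine B = card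
radial-torus-rigidity's `RadialTorusRigidity` with `eStar'` inlined). -/
def StubTorusRigidity : Prop :=
  ∃ a : ℝ, 47 / 50 ≤ a ∧ a ≤ 1 ∧ TorusRigidityAt a

/-- Read-back against the stub signature registered on the ledger (verbatim). -/
theorem stubTorusRigidity_iff : StubTorusRigidity ↔
    ∃ a : ℝ, 47 / 50 ≤ a ∧ a ≤ 1 ∧ ∀ δ : ℝ, 0 < δ → ∀ θ : ℝ, 0 < θ → ∃ η : ℝ, 0 < η ∧ ∀ P : PeriodicConfiguration 3, (∀ u ∈ P.points, ∀ v ∈ P.points, u ≠ v → δ ≤ dist u v) → P.energyPerParticle lennardJones ≤ (⨅ Q : PeriodicConfiguration 3, Q.energyPerParticle lennardJones) + η → ((P.motif.filter fun y => ¬ ({w ∈ P.points | w ≠ y ∧ dist y w ≤ a * (1 + 1 / 50)}.ncard = 12 ∧ ∀ w ∈ P.points, w ≠ y → a * (1 - 1 / 50) ≤ dist y w ∧ (dist y w ≤ a * (1 + 1 / 50) ∨ a * (63 / 50) ≤ dist y w))).card : ℝ) ≤ θ * P.motif.card :=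
  Iff.rfl

/-- Scale exclusivity, set version. [folklore] -/
theorem not_isGappedTwelveSet_of_isGappedTwelveSet {a a' : ℝ}
    (h1 : a * (1 + 1 / 50) < a' * (1 - 1 / 50)) (h2 : a' * (1 + 1 / 50) < a * (63 / 50))
    {S : Set E3} {y : E3} (h : IsGappedTwelveSet a' S y) : ¬ IsGappedTwelveSet a S y := by
  rintro ⟨-, hfar⟩
  obtain ⟨hcard, hfar'⟩ := h
  have hne : {w ∈ S | w ≠ y ∧ dist y w ≤ a' * (1 + 1 / 50)}.Nonempty :=
    Set.nonempty_of_ncard_ne_zero (by rw [hcard]; norm_num)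
  obtain ⟨w, hwS, hwy, hd⟩ := hne
  obtain ⟨hlo, -⟩ := hfar' w hwS hwy
  obtain ⟨-, hor⟩ := hfar w hwS hwy
  rcases hor with h | h <;> linarith

/-- At two exclusive scales the bad motif counts add up to at least `#motif`. [folklore] -/
theorem card_motif_le_bad_add_bad {a a' : ℝ}
    (h1 : a * (1 + 1 / 50) < a' * (1 - 1 / 50)) (h2 : a' * (1 + 1 / 50) < a * (63 / 50))
    (P : PeriodicConfiguration 3) :
    P.motif.card ≤ (P.motif.filter fun y => ¬ IsGappedTwelveSet a P.points y).card +
      (P.motif.filter fun y => ¬ IsGappedTwelveSet a' P.points y).card := by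
  have key : ∀ y ∈ P.motif, ¬ IsGappedTwelveSet a P.points y ∨ ¬ IsGappedTwelveSet a' P.points y :=
    fun y _ => by
      by_cases h : IsGappedTwelveSet a' P.points y
      · exact Or.inl (not_isGappedTwelveSet_of_isGappedTwelveSet h1 h2 h)
      · exact Or.inr h
  calc P.motif.card = (P.motif.filter fun y =>
        ¬ IsGappedTwelveSet a P.points y ∨ ¬ IsGappedTwelveSet a' P.points y).card := by
        rw [Finset.filter_true_of_mem key]
    _ ≤ _ := by rw [Finset.filter_or]; exact Finset.card_union_le _ _

/-- Separation transfers to the periodisation (general `δ ≤ 2`; the tree's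
`CoarseTierTransfer.separated_points` is the case `δ = 1/3`). [folklore] -/
theorem separated_points_of_le_two {N : ℕ} {x : Fin N → E3} {P : PeriodicConfiguration 3}
    (hPm : P.motif = Finset.univ.image x)
    (hPl : ∀ g ∈ P.lattice, g ≠ 0 → 2 * ∑ k, ‖x k‖ + 2 ≤ ‖g‖) {δ : ℝ} (hδ2 : δ ≤ 2)
    (hsep : ∀ i j : Fin N, i ≠ j → δ ≤ dist (x i) (x j)) :
    ∀ u ∈ P.points, ∀ v ∈ P.points, u ≠ v → δ ≤ dist u v := by
  rintro u ⟨z, hz, g, hg, rfl⟩ v hv huv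
  rw [hPm] at hz
  obtain ⟨i, -, rfl⟩ := Finset.mem_image.1 hz
  have hv' : v - g ∈ P.points := by
    have h := P.add_mem_points hv (P.lattice.neg_mem hg)
    simpa [sub_eq_add_neg] using h
  have hdist : dist (x i + g) v = dist (x i) (v - g) := by
    rw [dist_eq_norm, dist_eq_norm]
    congr 1
    abel
  rw [hdist]
  by_cases h : ∃ j, v - g = x j
  · obtain ⟨j, hj⟩ := h
    rw [hj]
    refine hsep i j ?_
    rintro rfl
    exact huv (sub_eq_iff_eq_add.1 hj).symm
  · push Not at h
    have h2 := CoarseTierTransfer.two_le_dist_of_mem_points hPm hPl i hv' h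
    linarith

/-- **Near-minimising separated periodic configurations exist at a FIXED separation**: there is
`δ > 0` (the minimal distance of LJ ground states, capped at `2`) such that for every `η > 0` some
`δ`-separated periodic `P` has `e(P) ≤ e* + η` — periodise a ground state `x^N` with `E(N)/N ≤ e* + η`
(`crysEnergyLimit`, `LennardJonesGroundStatesExist_holds`, `LennardJonesMinimalDistance_holds`,
`CoarseTierTransfer.exists_periodicConfiguration` / `energyPerParticle_le`).  This is the input the
skeleton's Bridge B feeds to the stub; here it powers the negative results below. [folklore] -/
theorem exists_sep_nearMin_periodic :
    ∃ δ : ℝ, 0 < δ ∧ ∀ η : ℝ, 0 < η → ∃ P : PeriodicConfiguration 3,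
      (∀ u ∈ P.points, ∀ v ∈ P.points, u ≠ v → δ ≤ dist u v) ∧
        P.energyPerParticle lennardJones ≤ eStar + η := by
  obtain ⟨δ₀, hδ₀, hsep⟩ := LennardJonesMinimalDistance_holds
  refine ⟨min δ₀ 2, lt_min hδ₀ two_pos, fun η hη => ?_⟩
  have hlim := Summit.AtomisticToContinuum.Crystallization.Theorems.ChargedEnergyGapNegative.crysEnergyLimit
  have hev : ∀ᶠ N : ℕ in atTop, groundStateEnergy lennardJones 3 N / N ∈ Set.Iio (eStar + η) :=
    hlim (Iio_mem_nhds (by unfold eStar; linarith))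
  obtain ⟨N, hN, hN1⟩ := (hev.and (eventually_ge_atTop 1)).exists
  have hNpos : 0 < N := hN1
  obtain ⟨x, hx⟩ := LennardJonesGroundStatesExist_holds N
  obtain ⟨P, hPm, hPl⟩ := CoarseTierTransfer.exists_periodicConfiguration x hNpos
  refine ⟨P, separated_points_of_le_two hPm hPl (min_le_right _ _)
    fun i j hij => (min_le_left _ _).trans (hsep N x hx i j hij), ?_⟩
  calc P.energyPerParticle lennardJones ≤ interactionEnergy lennardJones x / N :=
        CoarseTierTransfer.energyPerParticle_le hPm hPl hx.1 hNpos
    _ = groundStateEnergy lennardJones 3 N / N := by rw [hx.2]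
    _ ≤ eStar + η := le_of_lt hN

/-- **Torus rigidity cannot hold at two exclusive scales** (e.g. `a = 47/50` and `a' = 1`): feed a
`δ`-separated near-minimiser within `min η η'` of `e*` to both instances with `θ = 1/3`; every motif
point is bad at one of the two scales, so `#motif ≤ (2/3)·#motif`, i.e. the motif is empty —
impossible. [folklore] -/
theorem not_torusRigidityAt_and {a a' : ℝ}
    (h1 : a * (1 + 1 / 50) < a' * (1 - 1 / 50)) (h2 : a' * (1 + 1 / 50) < a * (63 / 50)) :
    ¬ (TorusRigidityAt a ∧ TorusRigidityAt a') := by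
  rintro ⟨ha, ha'⟩
  obtain ⟨δ, hδ, hnear⟩ := exists_sep_nearMin_periodic
  obtain ⟨η, hη, hP⟩ := ha δ hδ (1 / 3) (by norm_num)
  obtain ⟨η', hη', hP'⟩ := ha' δ hδ (1 / 3) (by norm_num)
  obtain ⟨P, hsepP, heP⟩ := hnear (min η η') (lt_min hη hη')
  have hb := hP P hsepP (heP.trans (by linarith [min_le_left η η']))
  have hb' := hP' P hsepP (heP.trans (by linarith [min_le_right η η']))
  have hc : (P.motif.card : ℝ) ≤ ((P.motif.filter fun y => ¬ IsGappedTwelveSet a P.points y).card : ℝ)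
      + ((P.motif.filter fun y => ¬ IsGappedTwelveSet a' P.points y).card : ℝ) := by
    exact_mod_cast card_motif_le_bad_add_bad h1 h2 P
  have hpos : (1 : ℝ) ≤ P.motif.card := by exact_mod_cast Finset.card_pos.2 P.motif_nonempty
  linarith

/-- **The stub is FALSE with `∀ a ∈ [47/50, 1]` in place of `∃ a`**: its scale, too, must be
selected (the window's ends are exclusive). [folklore] -/
theorem not_forall_torusRigidityAt :
    ¬ ∀ a : ℝ, 47 / 50 ≤ a → a ≤ 1 → TorusRigidityAt a := fun h =>
  not_torusRigidityAt_and (a := 47 / 50) (a' := 1) (by norm_num) (by norm_num)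
    ⟨h _ le_rfl (by norm_num), h 1 (by norm_num) le_rfl⟩

/-- The stub with the near-minimality hypothesis `e(P) ≤ e* + η` DROPPED (at scale `a`). -/
def TorusRigidityWithoutNearMinAt (a : ℝ) : Prop :=
  ∀ δ : ℝ, 0 < δ → ∀ θ : ℝ, 0 < θ →
    ∀ P : PeriodicConfiguration 3, (∀ u ∈ P.points, ∀ v ∈ P.points, u ≠ v → δ ≤ dist u v) →
      ((P.motif.filter fun y => ¬ IsGappedTwelveSet a P.points y).card : ℝ) ≤ θ * P.motif.card

/-- **Near-minimality is load-bearing in the stub**: without `e(P) ≤ e* + η` the statement fails at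
every scale `a ≤ 1` — witness the Bravais lattice obtained by periodising ONE point with periods of
length `≥ 2` (`CoarseTierTransfer.exists_periodicConfiguration`): it is `2`-separated and its single
motif point has an empty `1.02a`-shell, so it is bad; `1 ≤ θ·1` fails for `θ = 1/2`. [folklore] -/
theorem not_torusRigidityWithoutNearMinAt {a : ℝ} (ha : a ≤ 1) : ¬ TorusRigidityWithoutNearMinAt a := by
  intro h
  let x : Fin 1 → E3 := fun _ => 0
  obtain ⟨P, hPm, hPl⟩ := CoarseTierTransfer.exists_periodicConfiguration x one_pos
  have hsep : ∀ u ∈ P.points, ∀ v ∈ P.points, u ≠ v → (2 : ℝ) ≤ dist u v :=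
    separated_points_of_le_two hPm hPl le_rfl fun i j hij => absurd (Subsingleton.elim i j) hij
  have hb := h 2 two_pos (1 / 2) (by norm_num) P hsep
  have hall : (P.motif.filter fun y => ¬ IsGappedTwelveSet a P.points y) = P.motif := by
    refine Finset.filter_true_of_mem fun y hy => ?_
    rintro ⟨hcard, -⟩
    have hempty : {w ∈ P.points | w ≠ y ∧ dist y w ≤ a * (1 + 1 / 50)} = ∅ := by
      ext w
      simp only [Set.mem_setOf_eq, Set.mem_empty_iff_false, iff_false, not_and, not_le]
      intro hw hwy
      have h2 := hsep w hw y (P.mem_points_of_mem_motif hy) hwy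
      rw [dist_comm] at h2
      nlinarith
    rw [hempty, Set.ncard_empty] at hcard
    norm_num at hcard
  rw [hall] at hb
  have hpos : (1 : ℝ) ≤ P.motif.card := by exact_mod_cast Finset.card_pos.2 P.motif_nonempty
  linarith


/-! ## §6 Exact minimality is load-bearing to every order: `κ`-near ground states -/


/-! ### κ-near ground states -/

/-- `κ`-near ground state: distinct points whose energy is within the FRACTION `κ` of the optimal
binding, `E(x) ≤ (1 − κ)·E(N)` (recall `E(N) ≤ 0`); at `κ = 0` this is `IsGroundState V_LJ`. -/
def IsNearGroundState (κ : ℝ) {N : ℕ} (x : Fin N → E3) : Prop :=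
  Function.Injective x ∧
    interactionEnergy lennardJones x ≤ (1 - κ) * groundStateEnergy lennardJones 3 N

/-- The crux for sequences of `κ`-near ground states (`κ = 0`: the crux). -/
def RadialDefectsVanishNear (κ : ℝ) : Prop :=
  ∀ x : (N : ℕ) → (Fin N → E3), (∀ N, IsNearGroundState κ (x N)) → RadialConclusion x

/-- The dilated line has non-positive Lennard-Jones energy (all distances `≥ 2`). [folklore] -/
theorem interactionEnergy_dilatedLine_nonpos (N : ℕ) :
    interactionEnergy lennardJones (dilatedLine N) ≤ 0 := by
  unfold interactionEnergy
  refine Finset.sum_nonpos fun i _ => Finset.sum_nonpos fun j hj => ?_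
  have hne : j ≠ i := (Finset.mem_Ioi.1 hj).ne'
  exact lennardJones_nonpos (by linarith [two_le_dist_dilatedLine N hne])

/-- `E(N) ≤ 0` for Lennard-Jones in `ℝ³` (the dilated line has energy `≤ 0`). [folklore] -/
theorem groundStateEnergy_nonpos (N : ℕ) : groundStateEnergy lennardJones 3 N ≤ 0 :=
  (groundStateEnergy_lennardJones_le (dilatedLine_injective N)).trans
    (interactionEnergy_dilatedLine_nonpos N)

/-- At `κ = 0`, near ground states are exactly ground states (`E(N) ≤ E(x)` always). [folklore] -/
theorem isNearGroundState_zero_iff {N : ℕ} {x : Fin N → E3} :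
    IsNearGroundState 0 x ↔ IsGroundState lennardJones x := by
  constructor
  · rintro ⟨hx, hE⟩
    exact ⟨hx, le_antisymm (by simpa using hE) (groundStateEnergy_lennardJones_le hx)⟩
  · rintro ⟨hx, hE⟩
    exact ⟨hx, by rw [hE]; simp⟩

/-- Monotonicity in `κ` (uses `E(N) ≤ 0`). [folklore] -/
theorem IsNearGroundState.of_le {κ κ' : ℝ} (h : κ ≤ κ') {N : ℕ} {x : Fin N → E3}
    (hx : IsNearGroundState κ x) : IsNearGroundState κ' x :=
  ⟨hx.1, hx.2.trans (mul_le_mul_of_nonpos_right (by linarith) (groundStateEnergy_nonpos N))⟩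

/-- Ground states are `κ`-near for every `κ ≥ 0`. [folklore] -/
theorem isNearGroundState_of_isGroundState {κ : ℝ} (hκ : 0 ≤ κ) {N : ℕ} {x : Fin N → E3}
    (hx : IsGroundState lennardJones x) : IsNearGroundState κ x :=
  (isNearGroundState_zero_iff.2 hx).of_le hκ

/-- At `κ = 0` the near-ground-state crux IS the route decl. -/
theorem radialDefectsVanishNear_zero_iff : RadialDefectsVanishNear 0 ↔ RadialDefectsVanish := by
  rw [radialDefectsVanish_iff]
  unfold RadialDefectsVanishNear
  simp only [isNearGroundState_zero_iff]

/-- The family is antitone in `κ`. -/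
theorem RadialDefectsVanishNear.anti {κ κ' : ℝ} (h : κ ≤ κ') (H : RadialDefectsVanishNear κ') :
    RadialDefectsVanishNear κ := fun x hx => H x fun N => (hx N).of_le h

/-! ### Dilation covariance of the Lennard-Jones energy -/

/-- `V_LJ(λ r) ≤ λ⁻⁶ V_LJ(r)` for `λ ≥ 1`: the attraction scales exactly by `λ⁻⁶`, the repulsion by
`λ⁻¹² ≤ λ⁻⁶`. [folklore] -/
theorem lennardJones_mul_le {l r : ℝ} (hl : 1 ≤ l) (hr : 0 ≤ r) :
    lennardJones (l * r) ≤ l⁻¹ ^ 6 * lennardJones r := by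
  unfold lennardJones
  rw [mul_inv, mul_pow, mul_pow]
  have hm0 : 0 ≤ l⁻¹ := inv_nonneg.2 (by linarith)
  have hm1 : l⁻¹ ≤ 1 := inv_le_one_of_one_le₀ hl
  have hu : 0 ≤ r⁻¹ := inv_nonneg.2 hr
  have h6 : l⁻¹ ^ 6 ≤ 1 := pow_le_one₀ hm0 hm1
  have h6' : 0 ≤ l⁻¹ ^ 6 := pow_nonneg hm0 6
  have h12 : l⁻¹ ^ 12 = l⁻¹ ^ 6 * l⁻¹ ^ 6 := by ring
  have hu12 : 0 ≤ r⁻¹ ^ 12 := pow_nonneg hu 12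
  have key : 0 ≤ l⁻¹ ^ 6 * (1 - l⁻¹ ^ 6) * r⁻¹ ^ 12 :=
    mul_nonneg (mul_nonneg h6' (by linarith)) hu12
  nlinarith [key, h12]

/-- Hence `E_LJ(λ x) ≤ λ⁻⁶ E_LJ(x)` for every finite configuration and `λ ≥ 1`. [folklore] -/
theorem interactionEnergy_smul_le {N : ℕ} (x : Fin N → E3) {l : ℝ} (hl : 1 ≤ l) :
    interactionEnergy lennardJones (fun i => l • x i) ≤ l⁻¹ ^ 6 * interactionEnergy lennardJones x := by
  unfold interactionEnergy
  rw [Finset.mul_sum]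
  refine Finset.sum_le_sum fun i _ => ?_
  rw [Finset.mul_sum]
  refine Finset.sum_le_sum fun j _ => ?_
  rw [dist_smul₀, Real.norm_of_nonneg (by linarith : (0:ℝ) ≤ l)]
  exact lennardJones_mul_le hl dist_nonneg

/-! ### The mixture: `K` far-apart copies of a ground state plus one copy dilated by `21/20` -/

/-- A fixed sequence of Lennard-Jones ground states (they exist: tree fact). -/
def gs (N : ℕ) : Fin N → E3 := (LennardJonesGroundStatesExist_holds N).choose

/-- `gs N` is a ground state. [folklore] -/
theorem gs_isGroundState (N : ℕ) : IsGroundState lennardJones (gs N) :=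
  (LennardJonesGroundStatesExist_holds N).choose_spec

/-- The dilation factor `21/20`: scales `a` and `(20/21)·a` are exclusive (`0.98·21/20 = 1.029 > 1.02`,
`1.02·21/20 = 1.071 < 1.26`). -/
def dil : ℝ := 21 / 20

/-- The unit vector `e₀`. -/
def e0 : E3 := EuclideanSpace.single (0 : Fin 3) (1 : ℝ)

/-- `‖e₀‖ = 1`. [folklore] -/
theorem norm_e0 : ‖e0‖ = 1 := by simp [e0]

/-- Shift length between consecutive slots: `2·(21/20)·Σ‖x_k‖ + 2`. -/
def shiftLen (N : ℕ) : ℝ := 2 * (dil * ∑ k, ‖gs N k‖) + 2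

/-- Index type of the mixture: `K+1` copies of `Fin N` and `r` isolated extras. -/
abbrev Idx (K N r : ℕ) := (Fin (K + 1) × Fin N) ⊕ Fin r

/-- Dilation factor of copy `q`: `21/20` for the last copy, `1` otherwise. -/
def scale (K : ℕ) (q : Fin (K + 1)) : ℝ := if (q : ℕ) = K then dil else 1

/-- Slot number along the `e₀`-axis. -/
def slot {K N r : ℕ} : Idx K N r → ℕ := Sum.elim (fun p => (p.1 : ℕ)) (fun t => K + 1 + (t : ℕ))

/-- Position inside the slot. -/
def off {K N r : ℕ} : Idx K N r → E3 := Sum.elim (fun p => scale K p.1 • gs N p.2) (fun _ => 0)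

/-- The mixture, indexed by `Idx`. -/
def w (K N r : ℕ) (α : Idx K N r) : E3 := off α + ((slot α : ℕ) : ℝ) • (shiftLen N • e0)

/-- `1 ≤ 21/20`. [folklore] -/
theorem one_le_dil : (1 : ℝ) ≤ dil := by norm_num [dil]

/-- Every copy is dilated by a factor `≥ 1`. [folklore] -/
theorem one_le_scale (K : ℕ) (q : Fin (K + 1)) : 1 ≤ scale K q := by
  unfold scale; split_ifs <;> norm_num [dil]

/-- Dilation factors are positive. [folklore] -/
theorem scale_pos (K : ℕ) (q : Fin (K + 1)) : 0 < scale K q := one_pos.trans_le (one_le_scale K q)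

/-- Dilation factors are `≤ 21/20`. [folklore] -/
theorem scale_le_dil (K : ℕ) (q : Fin (K + 1)) : scale K q ≤ dil := by
  unfold scale; split_ifs <;> norm_num [dil]

/-- The last copy is the dilated one. [folklore] -/
theorem scale_last (K : ℕ) : scale K (Fin.last K) = dil := by simp [scale]

/-- The first `K` copies are undilated. [folklore] -/
theorem scale_castSucc (K : ℕ) (q : Fin K) : scale K q.castSucc = 1 := by
  simp [scale, ne_of_lt q.2]

/-- `0 ≤ Σ‖x_k‖`. [folklore] -/
theorem sum_norm_nonneg (N : ℕ) : 0 ≤ ∑ k, ‖gs N k‖ := Finset.sum_nonneg fun _ _ => norm_nonneg _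

/-- The shift length is positive. [folklore] -/
theorem shiftLen_pos (N : ℕ) : 0 < shiftLen N := by
  unfold shiftLen; have := sum_norm_nonneg N; nlinarith [one_le_dil]

/-- In-slot positions have norm `≤ (21/20)·Σ‖x_k‖`. [folklore] -/
theorem norm_off_le {K N r : ℕ} (α : Idx K N r) : ‖off α‖ ≤ dil * ∑ k, ‖gs N k‖ := by
  rcases α with ⟨q, s⟩ | t
  · simp only [off, Sum.elim_inl, norm_smul, Real.norm_of_nonneg (scale_pos K q).le]
    have hs : ‖gs N s‖ ≤ ∑ k, ‖gs N k‖ :=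
      Finset.single_le_sum (f := fun k => ‖gs N k‖) (fun _ _ => norm_nonneg _) (Finset.mem_univ s)
    have := scale_le_dil K q
    have h0 := (scale_pos K q).le
    nlinarith [norm_nonneg (gs N s)]
  · simp only [off, Sum.elim_inr, norm_zero]
    exact mul_nonneg (by norm_num [dil]) (sum_norm_nonneg N)

/-- Points in different slots are at distance `≥ 2`. -/
theorem two_le_dist_w {K N r : ℕ} {α β : Idx K N r} (h : slot α ≠ slot β) :
    2 ≤ dist (w K N r α) (w K N r β) := by
  have hL := shiftLen_pos N
  have h1 : (1 : ℝ) ≤ |((slot α : ℕ) : ℝ) - ((slot β : ℕ) : ℝ)| := by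
    rcases lt_or_gt_of_ne h with hlt | hgt
    · have : ((slot α : ℕ) : ℝ) + 1 ≤ ((slot β : ℕ) : ℝ) := by exact_mod_cast hlt
      rw [abs_sub_comm, abs_of_pos (by linarith)]; linarith
    · have : ((slot β : ℕ) : ℝ) + 1 ≤ ((slot α : ℕ) : ℝ) := by exact_mod_cast hgt
      rw [abs_of_pos (by linarith)]; linarith
  have hdecomp : w K N r α - w K N r β =
      (((slot α : ℕ) : ℝ) - ((slot β : ℕ) : ℝ)) • (shiftLen N • e0) + (off α - off β) := by
    simp only [w, sub_smul]; abel
  have hmain : |((slot α : ℕ) : ℝ) - ((slot β : ℕ) : ℝ)| * shiftLen N - (‖off α‖ + ‖off β‖) ≤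
      ‖w K N r α - w K N r β‖ := by
    rw [hdecomp]
    have hn : ‖(((slot α : ℕ) : ℝ) - ((slot β : ℕ) : ℝ)) • (shiftLen N • e0)‖ =
        |((slot α : ℕ) : ℝ) - ((slot β : ℕ) : ℝ)| * shiftLen N := by
      rw [norm_smul, norm_smul, norm_e0, mul_one, Real.norm_eq_abs, Real.norm_of_nonneg hL.le]
    have := norm_sub_norm_le ((((slot α : ℕ) : ℝ) - ((slot β : ℕ) : ℝ)) • (shiftLen N • e0))
      (-(off α - off β))
    rw [sub_neg_eq_add, norm_neg, hn] at this
    linarith [norm_sub_le (off α) (off β)]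
  rw [dist_eq_norm]
  have hα := norm_off_le α
  have hβ := norm_off_le β
  have hS : shiftLen N = 2 * (dil * ∑ k, ‖gs N k‖) + 2 := rfl
  nlinarith [hmain, h1, hα, hβ, hL]

/-- Inside one copy the distances are the dilated ground-state distances. -/
theorem dist_w_inl_inl {K N r : ℕ} (q : Fin (K + 1)) (s s' : Fin N) :
    dist (w K N r (Sum.inl (q, s))) (w K N r (Sum.inl (q, s'))) = scale K q * dist (gs N s) (gs N s') := by
  simp only [w, off, slot, Sum.elim_inl, dist_add_right, dist_smul₀,
    Real.norm_of_nonneg (scale_pos K q).le]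

/-- Slot of a copy point. [folklore] -/
theorem slot_inl {K N r : ℕ} (q : Fin (K + 1)) (s : Fin N) : slot (Sum.inl (q, s) : Idx K N r) = q := rfl

/-- Slot of an isolated extra. [folklore] -/
theorem slot_inr {K N r : ℕ} (t : Fin r) : slot (Sum.inr t : Idx K N r) = K + 1 + t := rfl

/-- The mixture has distinct points. -/
theorem w_injective (K N r : ℕ) : Function.Injective (w K N r) := by
  intro α β hαβ
  by_contra hne
  by_cases hs : slot α = slot β
  · rcases α with ⟨q, s⟩ | t <;> rcases β with ⟨q', s'⟩ | t'
    · simp only [slot_inl] at hs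
      have hq : q = q' := Fin.ext hs
      subst hq
      have hd := dist_w_inl_inl (K := K) (N := N) (r := r) q s s'
      rw [hαβ, dist_self] at hd
      have hss : dist (gs N s) (gs N s') = 0 := by
        have := scale_pos K q
        have h0 : scale K q * dist (gs N s) (gs N s') = 0 := hd.symm
        rcases mul_eq_zero.1 h0 with h | h
        · linarith
        · exact h
      rw [dist_eq_zero] at hss
      exact hne (by rw [(gs_isGroundState N).1 hss])
    · simp only [slot_inl, slot_inr] at hs
      have := q.2; omega
    · simp only [slot_inl, slot_inr] at hs
      have := q'.2; omega
    · simp only [slot_inr] at hs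
      exact hne (by rw [Fin.ext (by omega : (t : ℕ) = t')])
  · have h2 := two_le_dist_w (K := K) (N := N) (r := r) hs
    rw [hαβ, dist_self] at h2
    norm_num at h2


/-! ### Energy of the mixture -/

variable {K N r : ℕ}

/-- Cross-slot pair terms are `≤ 0` (distance `≥ 2 ≥ 1`). [folklore] -/
theorem lj_w_nonpos_of_slot_ne {α β : Idx K N r} (h : slot α ≠ slot β) :
    lennardJones (dist (w K N r α) (w K N r β)) ≤ 0 :=
  lennardJones_nonpos (by linarith [two_le_dist_w (K := K) (N := N) (r := r) h])

/-- Only the extra `t` itself sits in the slot of the extra `t`. [folklore] -/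
theorem slot_eq_slot_inr_iff {β : Idx K N r} {t : Fin r} :
    slot β = slot (Sum.inr t : Idx K N r) ↔ β = Sum.inr t := by
  constructor
  · intro hs
    rcases β with ⟨q', s'⟩ | t'
    · simp only [slot_inl, slot_inr] at hs; have := q'.2; omega
    · simp only [slot_inr] at hs; rw [Fin.ext (by omega : (t' : ℕ) = t)]
  · rintro rfl; rfl

/-- The site sum of an isolated extra is `≤ 0`. [folklore] -/
theorem sum_lj_w_inr_nonpos (t : Fin r) :
    ∑ β, lennardJones (dist (w K N r (Sum.inr t)) (w K N r β)) ≤ 0 := by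
  refine Finset.sum_nonpos fun β _ => ?_
  by_cases hβ : β = Sum.inr t
  · rw [hβ, dist_self, lennardJones_zero]
  · exact lj_w_nonpos_of_slot_ne fun hs => hβ (slot_eq_slot_inr_iff.1 hs.symm)

/-- The site sum of a copy point is at most its in-copy site sum. [folklore] -/
theorem sum_lj_w_inl_le (q : Fin (K + 1)) (s : Fin N) :
    ∑ β, lennardJones (dist (w K N r (Sum.inl (q, s))) (w K N r β)) ≤
      ∑ s', lennardJones (scale K q * dist (gs N s) (gs N s')) := by
  rw [Fintype.sum_sum_type]
  have h2 : ∑ t : Fin r, lennardJones (dist (w K N r (Sum.inl (q, s))) (w K N r (Sum.inr t))) ≤ 0 :=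
    Finset.sum_nonpos fun t _ => lj_w_nonpos_of_slot_ne (by
      simp only [slot_inl, slot_inr]; have := q.2; omega)
  have h1 : ∑ p : Fin (K + 1) × Fin N,
      lennardJones (dist (w K N r (Sum.inl (q, s))) (w K N r (Sum.inl p))) ≤
      ∑ s', lennardJones (scale K q * dist (gs N s) (gs N s')) := by
    rw [Fintype.sum_prod_type, ← Finset.add_sum_erase _ _ (Finset.mem_univ q)]
    have hrest : ∑ q' ∈ Finset.univ.erase q, ∑ s',
        lennardJones (dist (w K N r (Sum.inl (q, s))) (w K N r (Sum.inl (q', s')))) ≤ 0 := by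
      refine Finset.sum_nonpos fun q' hq' => Finset.sum_nonpos fun s' _ => ?_
      have hne : q' ≠ q := Finset.ne_of_mem_erase hq'
      exact lj_w_nonpos_of_slot_ne (by
        simp only [slot_inl]; exact fun h => hne (Fin.ext h).symm)
    have heq : ∑ s', lennardJones (dist (w K N r (Sum.inl (q, s))) (w K N r (Sum.inl (q, s')))) =
        ∑ s', lennardJones (scale K q * dist (gs N s) (gs N s')) :=
      Finset.sum_congr rfl fun s' _ => by rw [dist_w_inl_inl]
    linarith
  linarith

/-- The full double sum of the mixture is at most the sum of the in-copy double sums. [folklore] -/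
theorem sum_sum_lj_w_le :
    ∑ α, ∑ β, lennardJones (dist (w K N r α) (w K N r β)) ≤
      ∑ q : Fin (K + 1), ∑ s, ∑ s', lennardJones (scale K q * dist (gs N s) (gs N s')) := by
  rw [Fintype.sum_sum_type]
  have hinr : ∑ t : Fin r, ∑ β, lennardJones (dist (w K N r (Sum.inr t)) (w K N r β)) ≤ 0 :=
    Finset.sum_nonpos fun t _ => sum_lj_w_inr_nonpos t
  have hinl : ∑ p : Fin (K + 1) × Fin N, ∑ β, lennardJones (dist (w K N r (Sum.inl p)) (w K N r β)) ≤
      ∑ q : Fin (K + 1), ∑ s, ∑ s', lennardJones (scale K q * dist (gs N s) (gs N s')) := by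
    rw [Fintype.sum_prod_type]
    exact Finset.sum_le_sum fun q _ => Finset.sum_le_sum fun s _ => sum_lj_w_inl_le q s
  linarith

/-- The in-copy double sum at dilation `c` is twice the energy of the dilated ground state. [folklore] -/
theorem sum_sum_lj_smul {c : ℝ} (hc : 0 ≤ c) :
    ∑ s, ∑ s', lennardJones (c * dist (gs N s) (gs N s')) =
      2 * interactionEnergy lennardJones (fun s => c • gs N s) := by
  rw [two_mul_interactionEnergy_eq_sum_sum lennardJones lennardJones_zero]
  simp only [dist_smul₀, Real.norm_of_nonneg hc]

/-- Each copy contributes at most `2·c⁻⁶·E(N)`. [folklore] -/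
theorem copy_bound (q : Fin (K + 1)) :
    ∑ s, ∑ s', lennardJones (scale K q * dist (gs N s) (gs N s')) ≤
      2 * ((scale K q)⁻¹ ^ 6 * groundStateEnergy lennardJones 3 N) := by
  rw [sum_sum_lj_smul (scale_pos K q).le, ← (gs_isGroundState N).2]
  have := interactionEnergy_smul_le (gs N) (one_le_scale K q)
  linarith

/-- `Σ_q c_q⁻⁶ = K + (20/21)⁶`. [folklore] -/
theorem sum_scale_inv_pow (K : ℕ) : ∑ q : Fin (K + 1), (scale K q)⁻¹ ^ 6 = K + dil⁻¹ ^ 6 := by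
  rw [Fin.sum_univ_castSucc]
  simp [scale_castSucc, scale_last]

/-! ### The mixture on `Fin M` -/

/-- Block size `N = ⌊M/(K+1)⌋`. -/
def nBlk (K M : ℕ) : ℕ := M / (K + 1)

/-- Number of isolated extras `r = M mod (K+1)`. -/
def nRem (K M : ℕ) : ℕ := M % (K + 1)

/-- `M = (K+1)·⌊M/(K+1)⌋ + M mod (K+1)`. [folklore] -/
theorem nBlk_spec (K M : ℕ) : M = (K + 1) * nBlk K M + nRem K M :=
  (Nat.div_add_mod M (K + 1)).symm

/-- `Fin M ≃ (Fin (K+1) × Fin N) ⊕ Fin r`. -/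
def idxEquiv (K M : ℕ) : Fin M ≃ Idx K (nBlk K M) (nRem K M) :=
  (finCongr (nBlk_spec K M)).trans
    (finSumFinEquiv.symm.trans (Equiv.sumCongr finProdFinEquiv.symm (Equiv.refl _)))

/-- **The witness configuration of `M` particles**: `K` far-apart copies of the ground state of
`⌊M/(K+1)⌋` particles, one more copy dilated by `21/20`, and `M mod (K+1)` isolated particles. -/
def mix (K M : ℕ) : Fin M → E3 := w K (nBlk K M) (nRem K M) ∘ idxEquiv K M

/-- The witness has distinct points. [folklore] -/
theorem mix_injective (K M : ℕ) : Function.Injective (mix K M) :=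
  (w_injective K _ _).comp (idxEquiv K M).injective

/-- Twice the energy of the witness is the full double sum over the index type. [folklore] -/
theorem two_mul_interactionEnergy_mix (K M : ℕ) :
    2 * interactionEnergy lennardJones (mix K M) =
      ∑ α, ∑ β, lennardJones (dist (w K (nBlk K M) (nRem K M) α) (w K (nBlk K M) (nRem K M) β)) := by
  rw [two_mul_interactionEnergy_eq_sum_sum lennardJones lennardJones_zero]
  simp only [mix, Function.comp_apply]
  rw [Equiv.sum_comp (idxEquiv K M)
    (fun α => ∑ j, lennardJones (dist (w _ _ _ α) (w _ _ _ (idxEquiv K M j))))]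
  exact Finset.sum_congr rfl fun α _ =>
    Equiv.sum_comp (idxEquiv K M) (fun β => lennardJones (dist (w _ _ _ α) (w _ _ _ β)))

/-- **Energy of the witness**: `E(mix) ≤ (K + (20/21)⁶)·E(⌊M/(K+1)⌋)`. [folklore] -/
theorem interactionEnergy_mix_le (K M : ℕ) :
    interactionEnergy lennardJones (mix K M) ≤
      (K + dil⁻¹ ^ 6) * groundStateEnergy lennardJones 3 (nBlk K M) := by
  have h := two_mul_interactionEnergy_mix K M
  have h1 := sum_sum_lj_w_le (K := K) (N := nBlk K M) (r := nRem K M)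
  have h2 : ∑ q : Fin (K + 1), ∑ s, ∑ s',
      lennardJones (scale K q * dist (gs (nBlk K M) s) (gs (nBlk K M) s')) ≤
      ∑ q : Fin (K + 1), 2 * ((scale K q)⁻¹ ^ 6 * groundStateEnergy lennardJones 3 (nBlk K M)) :=
    Finset.sum_le_sum fun q _ => copy_bound q
  rw [← Finset.mul_sum, ← Finset.sum_mul, sum_scale_inv_pow] at h2
  linarith

/-! ### Counting good sites of the mixture -/

/-- Gapped-twelve at scale `a`, for a configuration on any finite index type (at `ι = Fin N` this is
`IsGappedTwelveAt` by `Iff.rfl`). -/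
def GoodAt (a : ℝ) {ι : Type*} [Fintype ι] [DecidableEq ι] (v : ι → E3) (α : ι) : Prop :=
  (Finset.univ.filter fun β : ι => β ≠ α ∧ dist (v α) (v β) ≤ a * (1 + 1 / 50)).card = 12 ∧
    ∀ β : ι, β ≠ α → a * (1 - 1 / 50) ≤ dist (v α) (v β) ∧
      (dist (v α) (v β) ≤ a * (1 + 1 / 50) ∨ a * (63 / 50) ≤ dist (v α) (v β))

/-- Read-back: `IsGappedTwelveAt` is `GoodAt` on `Fin N`. [folklore] -/
theorem isGappedTwelveAt_iff_goodAt (X : (N : ℕ) → (Fin N → E3)) (a : ℝ) (N : ℕ) (i : Fin N) :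
    IsGappedTwelveAt X a N i ↔ GoodAt a (X N) i := Iff.rfl

/-- `GoodAt` is invariant under re-indexing along an equivalence. [folklore] -/
theorem goodAt_comp_equiv {ι ι' : Type*} [Fintype ι] [DecidableEq ι] [Fintype ι'] [DecidableEq ι']
    (e : ι' ≃ ι) (v : ι → E3) (a : ℝ) (i : ι') : GoodAt a (v ∘ e) i ↔ GoodAt a v (e i) := by
  unfold GoodAt
  have hc : (Finset.univ.filter fun j : ι' =>
      j ≠ i ∧ dist ((v ∘ e) i) ((v ∘ e) j) ≤ a * (1 + 1 / 50)).card =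
      (Finset.univ.filter fun β : ι => β ≠ e i ∧ dist (v (e i)) (v β) ≤ a * (1 + 1 / 50)).card := by
    refine Finset.card_equiv e fun j => ?_
    simp only [Finset.mem_filter, Finset.mem_univ, true_and, Function.comp_apply,
      e.injective.ne_iff]
  rw [hc]
  refine and_congr_right fun _ => ⟨fun h β hβ => ?_, fun h j hj => ?_⟩
  · have := h (e.symm β) (fun h' => hβ (by rw [← h', e.apply_symm_apply]))
    simpa using this
  · exact h (e j) (e.injective.ne_iff.2 hj)

/-- Scale exclusivity for `GoodAt`. -/
theorem not_goodAt_of_goodAt {ι : Type*} [Fintype ι] [DecidableEq ι] {v : ι → E3} {α : ι} {a a' : ℝ}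
    (h1 : a * (1 + 1 / 50) < a' * (1 - 1 / 50)) (h2 : a' * (1 + 1 / 50) < a * (63 / 50))
    (h : GoodAt a' v α) : ¬ GoodAt a v α := by
  rintro ⟨-, hfar⟩
  obtain ⟨hcard, hfar'⟩ := h
  have hne : (Finset.univ.filter fun β : ι => β ≠ α ∧ dist (v α) (v β) ≤ a' * (1 + 1 / 50)).Nonempty := by
    rw [← Finset.card_pos, hcard]; norm_num
  obtain ⟨β, hβ⟩ := hne
  simp only [Finset.mem_filter, Finset.mem_univ, true_and] at hβ
  obtain ⟨hβα, hd⟩ := hβ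
  obtain ⟨hlo, -⟩ := hfar' β hβα
  obtain ⟨-, hor⟩ := hfar β hβα
  rcases hor with h | h <;> linarith

/-- At two exclusive scales the good sets are disjoint, so their sizes add up to at most `#ι`. -/
theorem card_good_add_card_good_le {ι : Type*} [Fintype ι] [DecidableEq ι] (v : ι → E3) {a a' : ℝ}
    (h1 : a * (1 + 1 / 50) < a' * (1 - 1 / 50)) (h2 : a' * (1 + 1 / 50) < a * (63 / 50)) :
    (Finset.univ.filter fun α => GoodAt a v α).card + (Finset.univ.filter fun α => GoodAt a' v α).card ≤
      Fintype.card ι := by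
  rw [← Finset.card_union_of_disjoint]
  · exact Finset.card_le_univ _
  · rw [Finset.disjoint_filter]
    exact fun α _ ha ha' => not_goodAt_of_goodAt h1 h2 ha' ha

/-- An isolated extra is never good (its bond shell is empty; `a ≤ 1`). -/
theorem not_goodAt_w_inr {a : ℝ} (ha : a ≤ 1) (t : Fin r) : ¬ GoodAt a (w K N r) (Sum.inr t) := by
  rintro ⟨hcard, -⟩
  have hempty : (Finset.univ.filter fun β : Idx K N r =>
      β ≠ Sum.inr t ∧ dist (w K N r (Sum.inr t)) (w K N r β) ≤ a * (1 + 1 / 50)) = ∅ := by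
    refine Finset.filter_eq_empty_iff.mpr ?_
    rintro β - ⟨hβ, hd⟩
    have h2 := two_le_dist_w (K := K) (N := N) (r := r) (α := Sum.inr t) (β := β)
      (fun hs => hβ (slot_eq_slot_inr_iff.1 hs.symm))
    nlinarith
  rw [hempty, Finset.card_empty] at hcard
  exact absurd hcard (by norm_num)

/-- **A good site of copy `q` of the mixture is a good site of the ground state at the undilated
scale `a / scale`** (far copies neither enter the `1.02a`-ball nor the annulus: they are `≥ 2` away). -/
theorem goodAt_gs_of_goodAt_w {a : ℝ} (ha1 : a ≤ 1) {q : Fin (K + 1)} {s : Fin N}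
    (h : GoodAt a (w K N r) (Sum.inl (q, s))) : GoodAt (a / scale K q) (gs N) s := by
  obtain ⟨hcard, hfar⟩ := h
  have hc : 0 < scale K q := scale_pos K q
  refine ⟨?_, fun s' hs' => ?_⟩
  · rw [← hcard]
    refine Finset.card_bij (fun s' _ => (Sum.inl (q, s') : Idx K N r)) ?_ ?_ ?_
    · intro s' hs'
      simp only [Finset.mem_filter, Finset.mem_univ, true_and] at hs' ⊢
      refine ⟨by simpa using hs'.1, ?_⟩
      rw [dist_w_inl_inl]
      have := hs'.2
      rw [div_mul_eq_mul_div, le_div_iff₀ hc] at this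
      linarith
    · intro s₁ _ s₂ _ h
      simpa using h
    · intro β hβ
      simp only [Finset.mem_filter, Finset.mem_univ, true_and] at hβ
      obtain ⟨hβα, hd⟩ := hβ
      have hslot : slot β = slot (Sum.inl (q, s) : Idx K N r) := by
        by_contra hs
        have h2 := two_le_dist_w (K := K) (N := N) (r := r) (Ne.symm hs)
        nlinarith
      rcases β with ⟨q', s'⟩ | t
      · simp only [slot_inl] at hslot
        have hq : q' = q := Fin.ext hslot
        subst hq
        refine ⟨s', ?_, rfl⟩
        simp only [Finset.mem_filter, Finset.mem_univ, true_and]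
        refine ⟨fun h => hβα (by rw [h]), ?_⟩
        rw [dist_w_inl_inl] at hd
        rw [div_mul_eq_mul_div, le_div_iff₀ hc]
        linarith
      · exact absurd (slot_eq_slot_inr_iff.1 hslot.symm) (by simp)
  · have hne : (Sum.inl (q, s') : Idx K N r) ≠ Sum.inl (q, s) := by simpa using hs'
    obtain ⟨hlo, hor⟩ := hfar _ hne
    rw [dist_w_inl_inl] at hlo hor
    refine ⟨?_, ?_⟩
    · rw [div_mul_eq_mul_div, div_le_iff₀ hc]
      linarith
    · rcases hor with h | h
      · left
        rw [div_mul_eq_mul_div, le_div_iff₀ hc]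
        linarith
      · right
        rw [div_mul_eq_mul_div, div_le_iff₀ hc]
        linarith

/-- `#{q : Fin (K+1) | q < K} = K`. [folklore] -/
theorem card_filter_val_lt (K : ℕ) :
    (Finset.univ.filter fun q : Fin (K + 1) => (q : ℕ) < K).card = K := by
  have : (Finset.univ.filter fun q : Fin (K + 1) => (q : ℕ) < K) = Finset.univ.erase (Fin.last K) := by
    ext q
    simp only [Finset.mem_filter, Finset.mem_univ, true_and, Finset.mem_erase, and_true, ne_eq,
      Fin.ext_iff, Fin.val_last]
    have := q.2
    omega
  rw [this, Finset.card_erase_of_mem (Finset.mem_univ _), Finset.card_univ, Fintype.card_fin]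
  omega

/-- **At every scale `a ∈ (0, 1]` at most `K·N` of the `(K+1)·N + r` sites of the mixture are
good**: good sites of the `K` undilated copies are good sites of `x^N` at scale `a`, those of the
dilated copy are good sites of `x^N` at the exclusive scale `(20/21)·a`, and the two good sets of `x^N`
are disjoint. [folklore] -/
theorem card_good_w_le {a : ℝ} (ha0 : 0 < a) (ha1 : a ≤ 1) (hK : 1 ≤ K) :
    (Finset.univ.filter fun α => GoodAt a (w K N r) α).card ≤ K * N := by
  set gA := (Finset.univ.filter fun s => GoodAt a (gs N) s).card with hgA
  set gB := (Finset.univ.filter fun s => GoodAt (a / dil) (gs N) s).card with hgB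
  -- the good set maps into (copies < K) × good(a) ∪ {last} × good(a/dil)
  let emb : Fin (K + 1) × Fin N ↪ Idx K N r := ⟨Sum.inl, Sum.inl_injective⟩
  have hsub : (Finset.univ.filter fun α => GoodAt a (w K N r) α) ⊆
      (((Finset.univ.filter fun q : Fin (K + 1) => (q : ℕ) < K) ×ˢ
          (Finset.univ.filter fun s => GoodAt a (gs N) s)) ∪
        ({Fin.last K} ×ˢ (Finset.univ.filter fun s => GoodAt (a / dil) (gs N) s))).map emb := by
    intro α hα
    simp only [Finset.mem_filter, Finset.mem_univ, true_and] at hα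
    rcases α with ⟨q, s⟩ | t
    · have hg := goodAt_gs_of_goodAt_w (K := K) (N := N) (r := r) ha1 hα
      rw [Finset.mem_map]
      refine ⟨(q, s), ?_, rfl⟩
      rw [Finset.mem_union, Finset.mem_product, Finset.mem_product]
      by_cases hq : (q : ℕ) = K
      · right
        have hql : q = Fin.last K := Fin.ext (by simp [hq])
        have hsc : scale K q = dil := by rw [hql, scale_last]
        rw [hsc] at hg
        exact ⟨by simp [hql], by simpa using hg⟩
      · left
        have hlt : (q : ℕ) < K := lt_of_le_of_ne (Nat.lt_succ_iff.1 q.2) hq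
        have hsc : scale K q = 1 := by simp [scale, hq]
        rw [hsc, div_one] at hg
        exact ⟨by simpa using hlt, by simpa using hg⟩
    · exact absurd hα (not_goodAt_w_inr ha1 t)
  have h1 := Finset.card_le_card hsub
  rw [Finset.card_map] at h1
  have h2 := Finset.card_union_le
    ((Finset.univ.filter fun q : Fin (K + 1) => (q : ℕ) < K) ×ˢ (Finset.univ.filter fun s => GoodAt a (gs N) s))
    ({Fin.last K} ×ˢ (Finset.univ.filter fun s => GoodAt (a / dil) (gs N) s))
  rw [Finset.card_product, Finset.card_product, card_filter_val_lt, Finset.card_singleton, one_mul,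
    ← hgA, ← hgB] at h2
  -- exclusivity of a/dil and a
  have hexcl := card_good_add_card_good_le (gs N) (a := a / dil) (a' := a)
    (by rw [dil]; nlinarith) (by rw [dil]; nlinarith)
  rw [← hgB, ← hgA, Fintype.card_fin] at hexcl
  have hA : gA ≤ N := by
    have := Finset.card_filter_le (Finset.univ : Finset (Fin N)) (fun s => GoodAt a (gs N) s)
    rwa [Finset.card_univ, Fintype.card_fin] at this
  obtain ⟨K', rfl⟩ : ∃ K', K = K' + 1 := ⟨K - 1, by omega⟩
  have : (K' + 1) * gA + gB ≤ (K' + 1) * N := by nlinarith [Nat.mul_le_mul_left K' hA]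
  omega

/-- Hence at most `K·⌊M/(K+1)⌋` sites of `mix K M` are good at any scale `a ∈ (0, 1]`. -/
theorem card_good_mix_le {a : ℝ} (ha0 : 0 < a) (ha1 : a ≤ 1) (hK : 1 ≤ K) (M : ℕ) :
    (Finset.univ.filter fun i : Fin M => GoodAt a (mix K M) i).card ≤ K * nBlk K M := by
  have : (Finset.univ.filter fun i : Fin M => GoodAt a (mix K M) i).card =
      (Finset.univ.filter fun α => GoodAt a (w K (nBlk K M) (nRem K M)) α).card := by
    refine Finset.card_equiv (idxEquiv K M) fun i => ?_
    simp only [Finset.mem_filter, Finset.mem_univ, true_and]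
    exact goodAt_comp_equiv (idxEquiv K M) _ a i
  rw [this]
  exact card_good_w_le ha0 ha1 hK

/-- The number of BAD sites of `mix K M` is at least `M − K·⌊M/(K+1)⌋ ≥ M/(K+1)`. -/
theorem le_natCard_bad_mix {a : ℝ} (ha0 : 0 < a) (ha1 : a ≤ 1) (hK : 1 ≤ K) (M : ℕ) :
    (M : ℝ) / (K + 1) ≤ Nat.card {i : Fin M // ¬ GoodAt a (mix K M) i} := by
  have hgood := card_good_mix_le (K := K) ha0 ha1 hK M
  have hbad : Nat.card {i : Fin M // ¬ GoodAt a (mix K M) i} + 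
      (Finset.univ.filter fun i : Fin M => GoodAt a (mix K M) i).card = M := by
    rw [Nat.card_eq_fintype_card, Fintype.card_subtype, Finset.filter_not,
      Finset.card_sdiff_add_card_eq_card (Finset.filter_subset _ _), Finset.card_univ, Fintype.card_fin]
  have hN : (K + 1) * nBlk K M ≤ M := by
    have := nBlk_spec K M; omega
  have h1 : (M : ℝ) ≤ (K + 1) * (Nat.card {i : Fin M // ¬ GoodAt a (mix K M) i} : ℝ) := by
    have : M ≤ (K + 1) * Nat.card {i : Fin M // ¬ GoodAt a (mix K M) i} := by nlinarith
    exact_mod_cast this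
  rw [div_le_iff₀ (by positivity)]
  linarith


/-! ### Assembly: the witness sequence and the refutation for every `κ > 0` -/

/-- The unit dimer. -/
def dimer : Fin 2 → E3 := ![(0 : E3), e0]

/-- `e₀ ≠ 0`. [folklore] -/
theorem e0_ne_zero : e0 ≠ 0 := by
  intro h; have := norm_e0; rw [h, norm_zero] at this; norm_num at this

/-- The dimer has distinct points. [folklore] -/
theorem dimer_injective : Function.Injective dimer := by
  intro i j h
  fin_cases i <;> fin_cases j
  · rfl
  · simp [dimer] at h; exact absurd h.symm e0_ne_zero
  · simp [dimer] at h; exact absurd h e0_ne_zero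
  · rfl

/-- First dimer point. [folklore] -/
theorem dimer_zero : dimer 0 = 0 := rfl

/-- Second dimer point. [folklore] -/
theorem dimer_one : dimer 1 = e0 := rfl

/-- The unit dimer has energy `V_LJ(1) = −1/12`. [folklore] -/
theorem interactionEnergy_dimer : interactionEnergy lennardJones dimer = -1 / 12 := by
  have h := two_mul_interactionEnergy_eq_sum_sum lennardJones lennardJones_zero dimer
  simp only [Fin.sum_univ_two, dimer_zero, dimer_one, dist_self, lennardJones_zero, dist_zero_right,
    norm_e0, lennardJones_one, norm_zero] at h
  rw [dist_comm, dist_zero_right, norm_e0, lennardJones_one] at h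
  linarith

/-- `e* < 0` (indeed `e* ≤ E(2)/2 ≤ −1/24`). [folklore] -/
theorem eStar_lt_zero : eStar < 0 := by
  have h1 := eStar_le_groundStateEnergy_div (N := 2) two_pos
  have h2 := groundStateEnergy_lennardJones_le (d := 3) dimer_injective
  rw [interactionEnergy_dimer] at h2
  have : groundStateEnergy lennardJones 3 2 / (2 : ℕ) ≤ -1 / 24 := by
    push_cast; linarith
  linarith

/-- **The mixture is eventually a `κ`-near ground state** (`0 < κ ≤ 1`, `κ·(K+1) ≥ 2`): its energy is
`≤ (K + (20/21)⁶)·E(N) ≤ (K + c)·N·(e* + ε)` with `E(N)/N → e*` (tree `crysEnergyLimit`), while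
`(1 − κ)·E(M) ≥ (1 − κ)·M·e*` (tree `N·e* ≤ E(N)`), and `(K + c) > (1 − κ)(K + 1) + 1`. [folklore] -/
theorem eventually_mix_near {κ : ℝ} (hκ0 : 0 < κ) (hκ1 : κ ≤ 1) {K : ℕ} (hK2 : 2 ≤ κ * (K + 1)) :
    ∀ᶠ M : ℕ in atTop,
      interactionEnergy lennardJones (mix K M) ≤ (1 - κ) * groundStateEnergy lennardJones 3 M := by
  have he := eStar_lt_zero
  set ε : ℝ := -eStar / (2 * (K + 1)) with hε
  have hK1 : (0 : ℝ) < K + 1 := by positivity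
  have hεpos : 0 < ε := div_pos (by linarith) (by positivity)
  have hev : ∀ᶠ N : ℕ in atTop, groundStateEnergy lennardJones 3 N / N ∈ Set.Iio (eStar + ε) :=
    crysEnergyLimit (Iio_mem_nhds (by unfold eStar; linarith))
  obtain ⟨N₀, hN₀⟩ := eventually_atTop.1 (hev.and (eventually_ge_atTop 1))
  refine eventually_atTop.2 ⟨(K + 1) * max N₀ (2 * K), fun M hM => ?_⟩
  have hNge : max N₀ (2 * K) ≤ nBlk K M := by
    rw [nBlk, Nat.le_div_iff_mul_le (Nat.succ_pos K), mul_comm]; exact hM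
  obtain ⟨hEN, hN1⟩ := hN₀ _ (le_of_max_le_left hNge)
  have h2K : 2 * K ≤ nBlk K M := le_of_max_le_right hNge
  have hmix := interactionEnergy_mix_le K M
  set N := nBlk K M with hN
  have hNr : (1 : ℝ) ≤ N := by exact_mod_cast hN1
  have h2Kr : 2 * (K : ℝ) ≤ N := by exact_mod_cast h2K
  have hENr : groundStateEnergy lennardJones 3 N ≤ N * eStar + N * ε := by
    have h' := hEN
    rw [Set.mem_Iio, div_lt_iff₀ (by linarith)] at h'
    unfold eStar at h' ⊢
    linarith
  have hMle : (M : ℝ) ≤ (K + 1) * N + K := by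
    have h1 := nBlk_spec K M
    have hr : nRem K M ≤ K := Nat.lt_succ_iff.1 (Nat.mod_lt _ (Nat.succ_pos K))
    have h1' : (M : ℝ) = (K + 1) * N + nRem K M := by rw [hN]; exact_mod_cast h1
    have hr' : (nRem K M : ℝ) ≤ K := by exact_mod_cast hr
    linarith
  have hMpos : 0 < M := by
    have h1 := nBlk_spec K M
    have h1' : 1 ≤ nBlk K M := hN1
    nlinarith
  have hEM : (M : ℝ) * eStar ≤ groundStateEnergy lennardJones 3 M := by
    have h' := eStar_le_groundStateEnergy_div hMpos
    rwa [le_div_iff₀ (by exact_mod_cast hMpos), mul_comm] at h'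
  have hc0 : (0 : ℝ) ≤ dil⁻¹ ^ 6 := by positivity
  have hc1 : dil⁻¹ ^ 6 ≤ 1 := by norm_num [dil]
  set c := dil⁻¹ ^ 6 with hc
  set E := groundStateEnergy lennardJones 3 N with hE
  set EM := groundStateEnergy lennardJones 3 M with hEM'
  have s3 : (K + c) * E ≤ (K + c) * (N * eStar + N * ε) :=
    mul_le_mul_of_nonneg_left hENr (by positivity)
  have s4 : (K + c) * (N * ε) ≤ -(N * eStar) / 2 := by
    have h' : (K + c) * (N * ε) ≤ (K + 1) * (N * ε) :=
      mul_le_mul_of_nonneg_right (by linarith) (by positivity)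
    have h'' : ((K : ℝ) + 1) * (N * ε) = -(N * eStar) / 2 := by
      rw [hε]; field_simp
    linarith
  have hNe : (N : ℝ) * eStar ≤ 0 := by nlinarith
  have s6 : (K + c) * (N * eStar) ≤ (K - 1) * (N * eStar) + N * eStar := by
    have h' : c * (N * eStar) ≤ 0 := mul_nonpos_of_nonneg_of_nonpos hc0 hNe
    nlinarith
  have s7 : (N : ℝ) * eStar / 2 ≤ K * eStar := by nlinarith
  have s8 : ((K : ℝ) - 1) * (N * eStar) ≤ (1 - κ) * (K + 1) * (N * eStar) := by
    have hcoef : (1 - κ) * ((K : ℝ) + 1) ≤ K - 1 := by linarith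
    nlinarith [mul_le_mul_of_nonpos_right hcoef hNe]
  have s9 : (K : ℝ) * eStar ≤ (1 - κ) * (K * eStar) := by
    have h' : (K : ℝ) * eStar ≤ 0 := by nlinarith
    nlinarith
  have s10 : (1 - κ) * (((K + 1) * N + K) * eStar) ≤ (1 - κ) * EM := by
    apply mul_le_mul_of_nonneg_left _ (by linarith)
    calc (((K : ℝ) + 1) * N + K) * eStar ≤ M * eStar := mul_le_mul_of_nonpos_right hMle he.le
      _ ≤ EM := hEM
  have hsplit : ((K : ℝ) + c) * (N * eStar + N * ε) = (K + c) * (N * eStar) + (K + c) * (N * ε) := by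
    ring
  linarith [hmix, s3, s4, s6, s7, s8, s9, s10, hsplit]

/-- **The witness sequence**: the mixture as soon as it is `κ`-near, a true ground state before. -/
def wit (κ : ℝ) (K M : ℕ) : Fin M → E3 :=
  if interactionEnergy lennardJones (mix K M) ≤ (1 - κ) * groundStateEnergy lennardJones 3 M
  then mix K M else gs M

/-- Every member of the witness sequence is a `κ`-near ground state (`κ ≥ 0`). [folklore] -/
theorem wit_isNearGroundState {κ : ℝ} (hκ : 0 ≤ κ) (K M : ℕ) : IsNearGroundState κ (wit κ K M) := by
  unfold wit
  split_ifs with h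
  · exact ⟨mix_injective K M, h⟩
  · exact isNearGroundState_of_isGroundState hκ (gs_isGroundState M)

/-- Eventually the witness is the mixture. [folklore] -/
theorem wit_eventually_eq {κ : ℝ} (hκ0 : 0 < κ) (hκ1 : κ ≤ 1) {K : ℕ} (hK2 : 2 ≤ κ * (K + 1)) :
    ∀ᶠ M : ℕ in atTop, wit κ K M = mix K M :=
  (eventually_mix_near hκ0 hκ1 hK2).mono fun M hM => by simp [wit, hM]

/-- The refutation for `0 < κ ≤ 1`. [folklore] -/
theorem not_radialDefectsVanishNear_of_le_one {κ : ℝ} (hκ0 : 0 < κ) (hκ1 : κ ≤ 1) :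
    ¬ RadialDefectsVanishNear κ := by
  intro h
  obtain ⟨K, hK⟩ := exists_nat_ge (2 / κ)
  have hK2 : 2 ≤ κ * (K + 1) := by
    have h' : 2 ≤ κ * K := by rw [div_le_iff₀ hκ0] at hK; linarith
    nlinarith
  have hK1 : 1 ≤ K := by
    rcases Nat.eq_zero_or_pos K with h0 | h0
    · subst h0; simp at hK2; linarith
    · exact h0
  obtain ⟨a, ha0, ha1, hθ⟩ := h (wit κ K) fun M => wit_isNearGroundState hκ0.le K M
  have hapos : 0 < a := by linarith
  have hKr : (0 : ℝ) < K + 1 := by positivity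
  have hfr := hθ (1 / (2 * (K + 1))) (by positivity)
  obtain ⟨M, hbad, hwM, hM1⟩ :=
    (hfr.and_eventually ((wit_eventually_eq hκ0 hκ1 hK2).and (eventually_ge_atTop 1))).exists
  have hbad' : (Nat.card {i : Fin M // ¬ GoodAt a (mix K M) i} : ℝ) ≤ 1 / (2 * (K + 1)) * M := by
    simpa only [isGappedTwelveAt_iff_goodAt, hwM] using hbad
  have hlow := le_natCard_bad_mix (K := K) hapos ha1 hK1 M
  have hM1r : (1 : ℝ) ≤ M := by exact_mod_cast hM1
  have hid : (M : ℝ) / (K + 1) = 2 * (1 / (2 * (K + 1)) * M) := by field_simp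
  have hpos : 0 < (M : ℝ) / (K + 1) := by positivity
  linarith

/-- **MINIMALITY IS LOAD-BEARING TO EVERY ORDER.** For EVERY `κ > 0` the crux fails for sequences of
`κ`-near ground states (`E(x^N) ≤ (1 − κ)·E(N)`, i.e. binding within the fraction `κ` of optimal):
witness = `K ≈ 2/κ` far-apart copies of a ground state plus one copy dilated by `21/20` — at EVERY scale
`a` at least `M/(K+1)` of its `M` sites are radially bad (scale exclusivity), for all `M` large.
Since `RadialDefectsVanishNear 0 ↔ RadialDefectsVanish` and the family is antitone in `κ`, the crux
sits exactly at the endpoint `κ = 0` of a family that is false on `(0, ∞)`: no argument that only uses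
`E(x^N) ≤ (1 − κ)E(N)` for a fixed `κ > 0` (equivalently: energy within `κ|e*|` per particle) can
prove it; a proof must exploit `E(x^N) − E(N) = o(N)` (here: `= 0`). Quantitatively, bad FRACTION
`θ` is compatible with excess energy `≈ (1 − (20/21)⁶)·|e*|·θ ≈ 0.25·|e*|·θ` per particle, so any
coercivity constant `g` in "excess ≥ g·#bad" obeys `g ≤ 0.254·|e*|` (numerics: true `g ≈ |e*|/400`).
[folklore] -/
theorem not_radialDefectsVanishNear {κ : ℝ} (hκ : 0 < κ) : ¬ RadialDefectsVanishNear κ := fun h =>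
  not_radialDefectsVanishNear_of_le_one (lt_min hκ one_pos) (min_le_right _ _)
    (h.anti (min_le_left _ _))

/-- **Certified cap on linear radial coercivity.** If `g·#bad_a(x) ≤ E_LJ(x) − M·e*` for ALL finite
injective configurations `x` of `ℝ³` at some scale `a ∈ (0, 1]` (`#bad_a` = number of sites that are not
gapped-twelve at scale `a`), then `g ≤ (1 − (20/21)⁶)·|e*| ≈ 0.254·|e*|`: test the inequality on the
mixture with `K = 1` (a ground state of `N` particles next to its `21/20`-dilate; `≥ N` of its `2N`
sites are bad at every scale, its excess energy is `≤ (1 − (20/21)⁶)·N·|e*| + o(N)`). [folklore] -/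
theorem radialCoercivity_cap {a g : ℝ} (ha0 : 0 < a) (ha1 : a ≤ 1)
    (h : ∀ (M : ℕ) (x : Fin M → E3), Function.Injective x →
      g * Nat.card {i : Fin M // ¬ GoodAt a x i} ≤ interactionEnergy lennardJones x - M * eStar) :
    g ≤ (1 - dil⁻¹ ^ 6) * (-eStar) := by
  by_contra hlt
  push Not at hlt
  have he := eStar_lt_zero
  have hc0 : (0 : ℝ) ≤ dil⁻¹ ^ 6 := by positivity
  have hc1 : dil⁻¹ ^ 6 ≤ 1 := by norm_num [dil]
  set c := dil⁻¹ ^ 6 with hc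
  set γ := g - (1 - c) * (-eStar) with hγ
  have hγpos : 0 < γ := by linarith
  have hgpos : 0 < g := by nlinarith
  have hev : ∀ᶠ N : ℕ in atTop, groundStateEnergy lennardJones 3 N / N ∈ Set.Iio (eStar + γ / 4) :=
    crysEnergyLimit (Iio_mem_nhds (by unfold eStar; linarith))
  obtain ⟨N, hEN, hN1⟩ := (hev.and (eventually_ge_atTop 1)).exists
  have hNr : (1 : ℝ) ≤ N := by exact_mod_cast hN1
  -- the mixture with K = 1 on M = 2N particles: nBlk 1 (2N) = N
  have hblk : nBlk 1 (2 * N) = N := by simp [nBlk]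
  have hM := h (2 * N) (mix 1 (2 * N)) (mix_injective 1 (2 * N))
  have hbad := le_natCard_bad_mix (K := 1) ha0 ha1 le_rfl (2 * N)
  have hmix := interactionEnergy_mix_le 1 (2 * N)
  rw [hblk] at hmix
  have hENr : groundStateEnergy lennardJones 3 N ≤ N * eStar + N * (γ / 4) := by
    have h' := hEN
    rw [Set.mem_Iio, div_lt_iff₀ (by linarith)] at h'
    unfold eStar at h' ⊢
    linarith
  push_cast at hM hbad hmix
  have hbad' : (N : ℝ) ≤ Nat.card {i : Fin (2 * N) // ¬ GoodAt a (mix 1 (2 * N)) i} := by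
    have : (2 * (N : ℝ)) / (1 + 1) = N := by ring
    linarith [hbad]
  have s1 : g * N ≤ g * Nat.card {i : Fin (2 * N) // ¬ GoodAt a (mix 1 (2 * N)) i} :=
    mul_le_mul_of_nonneg_left hbad' hgpos.le
  have s2 : ((1 : ℝ) + c) * groundStateEnergy lennardJones 3 N ≤ (1 + c) * (N * eStar + N * (γ / 4)) :=
    mul_le_mul_of_nonneg_left hENr (by linarith)
  have key : g * N ≤ N * ((1 - c) * (-eStar) + (1 + c) * (γ / 4)) := by
    have := hM
    nlinarith [s1, s2, hmix, this]
  have key2 : g ≤ (1 - c) * (-eStar) + (1 + c) * (γ / 4) := by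
    have := (mul_le_mul_iff_of_pos_right (by linarith : (0 : ℝ) < N)).1
      (by nlinarith [key] : g * N ≤ ((1 - c) * (-eStar) + (1 + c) * (γ / 4)) * N)
    exact this
  nlinarith [key2]

end Summit.AtomisticToContinuum.Crystallization.Cruxes.RadialDefectsVanish.Disproof

end
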